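import Literature.Analysis.Complex.ArgumentPrincipleRectangle
import HarnessLib

/-!
# A discrete winding-number certificate for zero-freeness on rectangles

Trunk T-ANA (Analysis/Complex). A general-purpose, purely analytic companion of the argument
principle on rectangles (`Literature.Analysis.Complex.integral_boundary_rect_logDeriv`): if the boundary of
`K = [a,b] × [c,d]` is cut into finitely many pieces and on each closed piece the analytic
function `f` takes its values in one of the four open half-planes
`H₀ = {Re w > 0}`, `H₁ = {Im w > 0}`, `H₂ = {Re w < 0}`, `H₃ = {Im w < 0}` (equivalently
`Re ((-i)^d w) > 0`), then `∮_{∂K} f'/f = (π/2) i · T`, where `T ∈ ℤ` is the number of signed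
quarter turns of the sequence of half-plane labels read counter-clockwise around `∂K`
(consecutive labels are never opposite, since the two half-planes share a point `f(z)`); hence
`4 · #{zeros of f in K°, with multiplicity} = T`, and `T = 0` certifies that `f` has no zero in
the open rectangle. This is the classical way of evaluating the change of argument along a
polygon from finitely many (validated) samples; it is the analytic half of the tree's certified
low-height computations for `ζ` and `ζ'` (Levinson–Montgomery route to Speiser's theorem).

Everything here is proved; the hypotheses "`f(piece) ⊂ H_d`" are left abstract (they are
discharged elsewhere by interval arithmetic).

## Main definitions and results

* `Literature.Complex.qrot d = (-i)^d` (`d : Fin 4`) and `Literature.Analysis.Complex.qturnOf`, `qturn d d'` — the signed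
  quarter turn from label `d` to label `d'` (`0, 1, -1`; opposite labels ↦ `0`, never used).
* `Literature.Analysis.Complex.log_qrot_sub_log_qrot` — the junction identity
  `log ((-i)^d w) - log ((-i)^{d'} w) = qturn d d' · (π/2) i` when `w ∈ H_d ∩ H_{d'}`.
* `Literature.Complex.HPieces f y x₀ L`, `VPieces f x y₀ L` — validity of a piece list
  `L : List (ℝ × Fin 4)` (next endpoint, label) along a horizontal / vertical segment;
  `piecesLast`, `piecesLastDir`, `piecesTurns`.
* `Literature.Analysis.Complex.integral_logDeriv_hpieces`, `integral_logDeriv_vpieces` — the exact value of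
  `∫ f'/f` along a certified edge: `log(last) - log(first) + turns · (π/2) i`.
* `Literature.Analysis.Complex.rectBoundaryIntegral_logDeriv_eq_turns` — `∮_{∂K} f'/f = (π/2) i · T`.
* `Literature.Analysis.Complex.no_zero_of_winding_certificate` — **`T = 0` ⇒ `f ≠ 0` on the open rectangle**.

## References

* P. Henrici, *Applied and Computational Complex Analysis*, Vol. 1, Wiley 1974, §4.6
  (principle of the argument evaluated along polygons) — classical background; the statements
  below are self-contained. [folklore]
-/

noncomputable section

open Complex Set MeasureTheory intervalIntegral
open scoped Real

namespace Literature.Analysis.Complex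

variable {a b c d : ℝ}

/-! ### Quadrant labels and the junction identity -/

/-- `qrot d = (-i)^d`: multiplication by `qrot d` turns the open half-plane number `d`
(`0`: right, `1`: upper, `2`: left, `3`: lower) onto the right half-plane. [folklore] -/
def qrot (d : Fin 4) : ℂ :=
  match d with
  | 0 => 1
  | 1 => -I
  | 2 => -1
  | 3 => I

/-- The signed quarter turn encoded by a label difference: `0 ↦ 0`, `1 ↦ 1`, `3 ↦ -1`
(and `2 ↦ 0`: opposite labels never occur at a junction). [folklore] -/
def qturnOf (e : Fin 4) : ℤ :=
  match e with
  | 0 => 0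
  | 1 => 1
  | 2 => 0
  | 3 => -1

/-- The signed quarter turn from label `d` to label `d'`. [folklore] -/
def qturn (d d' : Fin 4) : ℤ := qturnOf (d' - d)

/-- `qrot` is multiplicative: `qrot (d + e) = qrot d * qrot e`. [folklore] -/
lemma qrot_add (d e : Fin 4) : qrot (d + e) = qrot d * qrot e := by
  fin_cases d <;> fin_cases e <;> simp [qrot]

/-- `qrot d ≠ 0`. [folklore] -/
lemma qrot_ne_zero (d : Fin 4) : qrot d ≠ 0 := by
  fin_cases d <;> simp [qrot]

/-- If `Re u > 0` then `log (u · (-i)) = log u - (π/2) i`. [folklore] -/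
lemma log_mul_neg_I_of_re_pos {u : ℂ} (hu : 0 < u.re) :
    Complex.log (u * -I) = Complex.log u - π / 2 * I := by
  have hu0 : u ≠ 0 := fun h ↦ by simp [h] at hu
  have h1 : |arg u| < π / 2 := abs_arg_lt_pi_div_two_iff.2 (Or.inl hu)
  rw [abs_lt] at h1
  have key := (log_mul_eq_add_log_iff hu0 (show (-I : ℂ) ≠ 0 by simp)).2 (by
    rw [show (-I : ℂ) = -I from rfl, arg_neg_I]
    constructor <;> linarith [Real.pi_pos])
  rw [key, log_neg_I]
  ring

/-- If `Re u > 0` then `log (u · i) = log u + (π/2) i`. [folklore] -/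
lemma log_mul_I_of_re_pos {u : ℂ} (hu : 0 < u.re) :
    Complex.log (u * I) = Complex.log u + π / 2 * I := by
  have hu0 : u ≠ 0 := fun h ↦ by simp [h] at hu
  have h1 : |arg u| < π / 2 := abs_arg_lt_pi_div_two_iff.2 (Or.inl hu)
  rw [abs_lt] at h1
  have key := (log_mul_eq_add_log_iff hu0 I_ne_zero).2 (by
    rw [arg_I]
    constructor <;> linarith [Real.pi_pos])
  rw [key, log_I]

/-- **The junction identity.** If `w` lies in the half-planes `d` and `d'`, then
`log (qrot d · w) - log (qrot d' · w) = qturn d d' · (π/2) i` (and `d`, `d'` are not opposite).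
[folklore] -/
theorem log_qrot_sub_log_qrot {d d' : Fin 4} {w : ℂ} (h : 0 < (qrot d * w).re)
    (h' : 0 < (qrot d' * w).re) :
    Complex.log (qrot d * w) - Complex.log (qrot d' * w) = (qturn d d' : ℂ) * (π / 2) * I := by
  obtain ⟨e, rfl⟩ : ∃ e, d' = d + e := ⟨d' - d, by abel⟩
  have hq : qturn d (d + e) = qturnOf e := by simp [qturn]
  rw [qrot_add, mul_right_comm] at h'
  rw [hq, qrot_add, mul_right_comm]
  set u : ℂ := qrot d * w with hu
  fin_cases e
  · simp [qrot, qturnOf]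
  · simp only [qrot, qturnOf]
    rw [log_mul_neg_I_of_re_pos h]
    push_cast
    ring
  · simp only [qrot] at h'
    simp at h'
    linarith
  · simp only [qrot, qturnOf]
    rw [log_mul_I_of_re_pos h]
    push_cast
    ring

/-! ### Certified piece lists along a segment -/

/-- The last endpoint of a piece list started at `x₀`. [folklore] -/
def piecesLast (x₀ : ℝ) : List (ℝ × Fin 4) → ℝ
  | [] => x₀
  | (x₁, _) :: L => piecesLast x₁ L

/-- The last label of a piece list whose first label is `d`. [folklore] -/
def piecesLastDir (d : Fin 4) : List (ℝ × Fin 4) → Fin 4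
  | [] => d
  | (_, d') :: L => piecesLastDir d' L

/-- The sum of the signed quarter turns at the junctions of a piece list whose first label is
`d`. [folklore] -/
def piecesTurns (d : Fin 4) : List (ℝ × Fin 4) → ℤ
  | [] => 0
  | (_, d') :: L => qturn d d' + piecesTurns d' L

/-- [folklore] -/
@[simp] lemma piecesLast_nil (x₀ : ℝ) : piecesLast x₀ [] = x₀ := rfl
/-- [folklore] -/
@[simp] lemma piecesLast_cons (x₀ x₁ : ℝ) (d : Fin 4) (L : List (ℝ × Fin 4)) :
    piecesLast x₀ ((x₁, d) :: L) = piecesLast x₁ L := rfl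
/-- [folklore] -/
@[simp] lemma piecesLastDir_nil (d : Fin 4) : piecesLastDir d [] = d := rfl
/-- [folklore] -/
@[simp] lemma piecesLastDir_cons (d d' : Fin 4) (x : ℝ) (L : List (ℝ × Fin 4)) :
    piecesLastDir d ((x, d') :: L) = piecesLastDir d' L := rfl
/-- [folklore] -/
@[simp] lemma piecesTurns_nil (d : Fin 4) : piecesTurns d [] = 0 := rfl
/-- [folklore] -/
@[simp] lemma piecesTurns_cons (d d' : Fin 4) (x : ℝ) (L : List (ℝ × Fin 4)) :
    piecesTurns d ((x, d') :: L) = qturn d d' + piecesTurns d' L := rfl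

/-- Validity of a piece list along the horizontal line `Im z = y`, starting at `x₀`: the entry
`(x₁, d₁)` closes the piece `[x₀, x₁]` and records its label `d₁`, i.e. `x₀ ≤ x₁` and
`Re (qrot d₁ · f(x + iy)) > 0` for all `x ∈ [x₀, x₁]`; the rest of the list is a valid piece list
starting at `x₁`. [folklore] -/
def HPieces (f : ℂ → ℂ) (y : ℝ) : ℝ → List (ℝ × Fin 4) → Prop
  | _, [] => True
  | x₀, (x₁, d₁) :: L =>
      x₀ ≤ x₁ ∧ (∀ x ∈ Icc x₀ x₁, 0 < (qrot d₁ * f (x + y * I)).re) ∧ HPieces f y x₁ L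

/-- Validity of a piece list along the vertical line `Re z = x`. [folklore] -/
def VPieces (f : ℂ → ℂ) (x : ℝ) : ℝ → List (ℝ × Fin 4) → Prop
  | _, [] => True
  | y₀, (y₁, d₁) :: L =>
      y₀ ≤ y₁ ∧ (∀ y ∈ Icc y₀ y₁, 0 < (qrot d₁ * f (x + y * I)).re) ∧ VPieces f x y₁ L

/-- [folklore] -/
@[simp] lemma HPieces_nil (f : ℂ → ℂ) (y x₀ : ℝ) : HPieces f y x₀ [] := trivial
/-- Unfolding of `HPieces` on a cons. [folklore] -/
lemma HPieces_cons {f : ℂ → ℂ} {y x₀ x₁ : ℝ} {d₁ : Fin 4} {L : List (ℝ × Fin 4)} :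
    HPieces f y x₀ ((x₁, d₁) :: L) ↔
      x₀ ≤ x₁ ∧ (∀ x ∈ Icc x₀ x₁, 0 < (qrot d₁ * f (x + y * I)).re) ∧ HPieces f y x₁ L :=
  Iff.rfl
/-- [folklore] -/
@[simp] lemma VPieces_nil (f : ℂ → ℂ) (x y₀ : ℝ) : VPieces f x y₀ [] := trivial
/-- Unfolding of `VPieces` on a cons. [folklore] -/
lemma VPieces_cons {f : ℂ → ℂ} {x y₀ y₁ : ℝ} {d₁ : Fin 4} {L : List (ℝ × Fin 4)} :
    VPieces f x y₀ ((y₁, d₁) :: L) ↔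
      y₀ ≤ y₁ ∧ (∀ y ∈ Icc y₀ y₁, 0 < (qrot d₁ * f (x + y * I)).re) ∧ VPieces f x y₁ L :=
  Iff.rfl

/-- The endpoints of a valid horizontal piece list increase. [folklore] -/
lemma HPieces.le_piecesLast {f : ℂ → ℂ} {y : ℝ} :
    ∀ {x₀ : ℝ} {L : List (ℝ × Fin 4)}, HPieces f y x₀ L → x₀ ≤ piecesLast x₀ L
  | _, [], _ => le_rfl
  | _, (_, _) :: _, h => h.1.trans (HPieces.le_piecesLast h.2.2)

/-- The endpoints of a valid vertical piece list increase. [folklore] -/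
lemma VPieces.le_piecesLast {f : ℂ → ℂ} {x : ℝ} :
    ∀ {y₀ : ℝ} {L : List (ℝ × Fin 4)}, VPieces f x y₀ L → y₀ ≤ piecesLast y₀ L
  | _, [], _ => le_rfl
  | _, (_, _) :: _, h => h.1.trans (VPieces.le_piecesLast h.2.2)

/-- On a valid horizontal piece list, `f ≠ 0` along the whole segment. [folklore] -/
lemma HPieces.ne_zero {f : ℂ → ℂ} {y : ℝ} :
    ∀ {x₀ : ℝ} {L : List (ℝ × Fin 4)}, HPieces f y x₀ L →
      ∀ x ∈ Icc x₀ (piecesLast x₀ L), L ≠ [] → f (x + y * I) ≠ 0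
  | _, [], _, _, _, h => (h rfl).elim
  | x₀, (x₁, d₁) :: L, h, x, hx, _ => by
    rcases le_or_gt x x₁ with hle | hgt
    · intro h0
      have := h.2.1 x ⟨hx.1, hle⟩
      simp [h0] at this
    · rcases L with _ | ⟨⟨x₂, d₂⟩, L'⟩
      · simp at hx; linarith
      · exact HPieces.ne_zero h.2.2 x ⟨hgt.le, by simpa using hx.2⟩ (by simp)

/-- On a valid vertical piece list, `f ≠ 0` along the whole segment. [folklore] -/
lemma VPieces.ne_zero {f : ℂ → ℂ} {x : ℝ} :
    ∀ {y₀ : ℝ} {L : List (ℝ × Fin 4)}, VPieces f x y₀ L →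
      ∀ y ∈ Icc y₀ (piecesLast y₀ L), L ≠ [] → f (x + y * I) ≠ 0
  | _, [], _, _, _, h => (h rfl).elim
  | y₀, (y₁, d₁) :: L, h, y, hy, _ => by
    rcases le_or_gt y y₁ with hle | hgt
    · intro h0
      have := h.2.1 y ⟨hy.1, hle⟩
      simp [h0] at this
    · rcases L with _ | ⟨⟨y₂, d₂⟩, L'⟩
      · simp at hy; linarith
      · exact VPieces.ne_zero h.2.2 y ⟨hgt.le, by simpa using hy.2⟩ (by simp)

/-- The first-piece condition also holds at the left endpoint. [folklore] -/
lemma HPieces.re_pos_head {f : ℂ → ℂ} {y x₀ x₁ : ℝ} {d₁ : Fin 4} {L : List (ℝ × Fin 4)}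
    (h : HPieces f y x₀ ((x₁, d₁) :: L)) : 0 < (qrot d₁ * f (x₀ + y * I)).re :=
  h.2.1 x₀ ⟨le_rfl, h.1⟩

/-- The first-piece condition at the bottom endpoint (vertical). [folklore] -/
lemma VPieces.re_pos_head {f : ℂ → ℂ} {x y₀ y₁ : ℝ} {d₁ : Fin 4} {L : List (ℝ × Fin 4)}
    (h : VPieces f x y₀ ((y₁, d₁) :: L)) : 0 < (qrot d₁ * f (x + y₀ * I)).re :=
  h.2.1 y₀ ⟨le_rfl, h.1⟩

/-- The last-piece condition holds at the right endpoint. [folklore] -/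
lemma HPieces.re_pos_last {f : ℂ → ℂ} {y : ℝ} :
    ∀ {x₀ x₁ : ℝ} {d₁ : Fin 4} {L : List (ℝ × Fin 4)}, HPieces f y x₀ ((x₁, d₁) :: L) →
      0 < (qrot (piecesLastDir d₁ L) * f (piecesLast x₁ L + y * I)).re
  | x₀, x₁, d₁, [], h => by simpa using h.2.1 x₁ ⟨h.1, le_rfl⟩
  | x₀, x₁, d₁, (x₂, d₂) :: L, h => by
    simpa using HPieces.re_pos_last (x₀ := x₁) h.2.2

/-- The last-piece condition at the top endpoint (vertical). [folklore] -/
lemma VPieces.re_pos_last {f : ℂ → ℂ} {x : ℝ} :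
    ∀ {y₀ y₁ : ℝ} {d₁ : Fin 4} {L : List (ℝ × Fin 4)}, VPieces f x y₀ ((y₁, d₁) :: L) →
      0 < (qrot (piecesLastDir d₁ L) * f (x + piecesLast y₁ L * I)).re
  | y₀, y₁, d₁, [], h => by simpa using h.2.1 y₁ ⟨h.1, le_rfl⟩
  | y₀, y₁, d₁, (y₂, d₂) :: L, h => by
    simpa using VPieces.re_pos_last (y₀ := y₁) h.2.2

/-! ### Exact edge integrals -/

/-- One certified horizontal piece: `∫_{x₀}^{x₁} f'/f = log(qrot d · f(x₁+iy)) - log(qrot d · f(x₀+iy))`.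
[folklore] -/
lemma integral_logDeriv_hpiece {f : ℂ → ℂ} {y x₀ x₁ : ℝ} {d : Fin 4} (h01 : x₀ ≤ x₁)
    (hf : ∀ x ∈ Icc x₀ x₁, AnalyticAt ℂ f (x + y * I))
    (hd : ∀ x ∈ Icc x₀ x₁, 0 < (qrot d * f (x + y * I)).re) :
    ∫ x : ℝ in x₀..x₁, deriv f (x + y * I) / f (x + y * I) =
      Complex.log (qrot d * f (x₁ + y * I)) - Complex.log (qrot d * f (x₀ + y * I)) := by
  have key : ∀ z, AnalyticAt ℂ f z →
      deriv (fun w ↦ qrot d * f w) z / (qrot d * f z) = deriv f z / f z := by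
    intro z hz
    rw [deriv_const_mul _ hz.differentiableAt, mul_div_mul_left _ _ (qrot_ne_zero d)]
  have h := integral_logDeriv_horizontal (g := fun w ↦ qrot d * f w) y h01
    (fun x hx ↦ analyticAt_const.mul (hf x hx)) (fun x hx ↦ Or.inl (hd x hx))
  rw [intervalIntegral.integral_congr (fun x hx ↦ key _ (hf x (by rwa [uIcc_of_le h01] at hx)))]
    at h
  exact h

/-- One certified vertical piece. [folklore] -/
lemma integral_logDeriv_vpiece {f : ℂ → ℂ} {x y₀ y₁ : ℝ} {d : Fin 4} (h01 : y₀ ≤ y₁)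
    (hf : ∀ y ∈ Icc y₀ y₁, AnalyticAt ℂ f (x + y * I))
    (hd : ∀ y ∈ Icc y₀ y₁, 0 < (qrot d * f (x + y * I)).re) :
    I * ∫ y : ℝ in y₀..y₁, deriv f (x + y * I) / f (x + y * I) =
      Complex.log (qrot d * f (x + y₁ * I)) - Complex.log (qrot d * f (x + y₀ * I)) := by
  have key : ∀ z, AnalyticAt ℂ f z →
      deriv (fun w ↦ qrot d * f w) z / (qrot d * f z) = deriv f z / f z := by
    intro z hz
    rw [deriv_const_mul _ hz.differentiableAt, mul_div_mul_left _ _ (qrot_ne_zero d)]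
  have h := integral_logDeriv_vertical (g := fun w ↦ qrot d * f w) x h01
    (fun y hy ↦ analyticAt_const.mul (hf y hy)) (fun y hy ↦ Or.inl (hd y hy))
  rw [intervalIntegral.integral_congr (fun y hy ↦ key _ (hf y (by rwa [uIcc_of_le h01] at hy)))]
    at h
  exact h

/-- Interval integrability of `f'/f` along a horizontal segment where `f` is analytic and
non-zero. [folklore] -/
lemma intervalIntegrable_logDeriv_horizontal {f : ℂ → ℂ} {y x₀ x₁ : ℝ} (h01 : x₀ ≤ x₁)
    (hf : ∀ x ∈ Icc x₀ x₁, AnalyticAt ℂ f (x + y * I))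
    (h0 : ∀ x ∈ Icc x₀ x₁, f (x + y * I) ≠ 0) :
    IntervalIntegrable (fun x : ℝ ↦ deriv f (x + y * I) / f (x + y * I)) volume x₀ x₁ :=
  intervalIntegrable_of_continuousAt_horizontal (F := fun z ↦ deriv f z / f z) y h01
    fun x hx ↦ (hf x hx).deriv.continuousAt.div (hf x hx).continuousAt (h0 x hx)

/-- Interval integrability of `f'/f` along a vertical segment. [folklore] -/
lemma intervalIntegrable_logDeriv_vertical {f : ℂ → ℂ} {x y₀ y₁ : ℝ} (h01 : y₀ ≤ y₁)
    (hf : ∀ y ∈ Icc y₀ y₁, AnalyticAt ℂ f (x + y * I))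
    (h0 : ∀ y ∈ Icc y₀ y₁, f (x + y * I) ≠ 0) :
    IntervalIntegrable (fun y : ℝ ↦ deriv f (x + y * I) / f (x + y * I)) volume y₀ y₁ :=
  intervalIntegrable_of_continuousAt_vertical (F := fun z ↦ deriv f z / f z) x h01
    fun y hy ↦ (hf y hy).deriv.continuousAt.div (hf y hy).continuousAt (h0 y hy)

/-- **Exact integral along a certified horizontal edge**:
`∫_{x₀}^{last} f'/f(x+iy) dx = log(qrot d_last · f(last+iy)) - log(qrot d₁ · f(x₀+iy)) + turns · (π/2) i`.
[folklore] -/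
theorem integral_logDeriv_hpieces {f : ℂ → ℂ} {y : ℝ} :
    ∀ {x₀ x₁ : ℝ} {d₁ : Fin 4} {L : List (ℝ × Fin 4)}, HPieces f y x₀ ((x₁, d₁) :: L) →
      (∀ x ∈ Icc x₀ (piecesLast x₁ L), AnalyticAt ℂ f (x + y * I)) →
      ∫ x : ℝ in x₀..piecesLast x₁ L, deriv f (x + y * I) / f (x + y * I) =
        Complex.log (qrot (piecesLastDir d₁ L) * f (piecesLast x₁ L + y * I)) -
          Complex.log (qrot d₁ * f (x₀ + y * I)) + (piecesTurns d₁ L : ℂ) * (π / 2) * I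
  | x₀, x₁, d₁, [], h, hf => by
    simp only [piecesLast_nil, piecesLastDir_nil, piecesTurns_nil, Int.cast_zero, zero_mul,
      add_zero]
    exact integral_logDeriv_hpiece h.1 (by simpa using hf) h.2.1
  | x₀, x₁, d₁, (x₂, d₂) :: L, h, hf => by
    have h1 : x₀ ≤ x₁ := h.1
    have htail : HPieces f y x₁ ((x₂, d₂) :: L) := h.2.2
    have h2 : x₁ ≤ piecesLast x₂ L := by
      have := htail.le_piecesLast; simpa using this
    have hf1 : ∀ x ∈ Icc x₀ x₁, AnalyticAt ℂ f (x + y * I) := fun x hx ↦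
      hf x ⟨hx.1, hx.2.trans (by simpa using h2)⟩
    have hf2 : ∀ x ∈ Icc x₁ (piecesLast x₂ L), AnalyticAt ℂ f (x + y * I) := fun x hx ↦
      hf x ⟨h1.trans hx.1, by simpa using hx.2⟩
    have ih := integral_logDeriv_hpieces htail hf2
    have hpiece := integral_logDeriv_hpiece h1 hf1 h.2.1
    have hjunction := log_qrot_sub_log_qrot (h.2.1 x₁ ⟨h1, le_rfl⟩) htail.re_pos_head
    simp only [piecesLast_cons, piecesLastDir_cons, piecesTurns_cons, Int.cast_add]
    rw [← integral_add_adjacent_intervals (b := x₁)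
        (intervalIntegrable_logDeriv_horizontal h1 hf1 (fun x hx h0 ↦ by
          have := h.2.1 x hx; simp [h0] at this))
        (intervalIntegrable_logDeriv_horizontal h2 hf2 (fun x hx ↦
          htail.ne_zero x (by simpa using hx) (by simp))),
      hpiece, ih]
    linear_combination hjunction

/-- **Exact integral along a certified vertical edge**. [folklore] -/
theorem integral_logDeriv_vpieces {f : ℂ → ℂ} {x : ℝ} :
    ∀ {y₀ y₁ : ℝ} {d₁ : Fin 4} {L : List (ℝ × Fin 4)}, VPieces f x y₀ ((y₁, d₁) :: L) →
      (∀ y ∈ Icc y₀ (piecesLast y₁ L), AnalyticAt ℂ f (x + y * I)) →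
      I * ∫ y : ℝ in y₀..piecesLast y₁ L, deriv f (x + y * I) / f (x + y * I) =
        Complex.log (qrot (piecesLastDir d₁ L) * f (x + piecesLast y₁ L * I)) -
          Complex.log (qrot d₁ * f (x + y₀ * I)) + (piecesTurns d₁ L : ℂ) * (π / 2) * I
  | y₀, y₁, d₁, [], h, hf => by
    simp only [piecesLast_nil, piecesLastDir_nil, piecesTurns_nil, Int.cast_zero, zero_mul,
      add_zero]
    exact integral_logDeriv_vpiece h.1 (by simpa using hf) h.2.1
  | y₀, y₁, d₁, (y₂, d₂) :: L, h, hf => by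
    have h1 : y₀ ≤ y₁ := h.1
    have htail : VPieces f x y₁ ((y₂, d₂) :: L) := h.2.2
    have h2 : y₁ ≤ piecesLast y₂ L := by
      have := htail.le_piecesLast; simpa using this
    have hf1 : ∀ y ∈ Icc y₀ y₁, AnalyticAt ℂ f (x + y * I) := fun y hy ↦
      hf y ⟨hy.1, hy.2.trans (by simpa using h2)⟩
    have hf2 : ∀ y ∈ Icc y₁ (piecesLast y₂ L), AnalyticAt ℂ f (x + y * I) := fun y hy ↦
      hf y ⟨h1.trans hy.1, by simpa using hy.2⟩
    have ih := integral_logDeriv_vpieces htail hf2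
    have hpiece := integral_logDeriv_vpiece h1 hf1 h.2.1
    have hjunction := log_qrot_sub_log_qrot (h.2.1 y₁ ⟨h1, le_rfl⟩) htail.re_pos_head
    simp only [piecesLast_cons, piecesLastDir_cons, piecesTurns_cons, Int.cast_add]
    rw [← integral_add_adjacent_intervals (b := y₁)
        (intervalIntegrable_logDeriv_vertical h1 hf1 (fun y hy h0 ↦ by
          have := h.2.1 y hy; simp [h0] at this))
        (intervalIntegrable_logDeriv_vertical h2 hf2 (fun y hy ↦
          htail.ne_zero y (by simpa using hy) (by simp))),
      mul_add, hpiece, ih]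
    linear_combination hjunction

/-! ### The certificate theorem -/

/-- The total signed quarter-turn count of a rectangle certificate, read counter-clockwise:
bottom (left to right), corner, right (upwards), corner, top (right to left, i.e. minus its
left-to-right turns), corner, left (downwards), corner. [folklore] -/
def certTurns (dB : Fin 4) (LB : List (ℝ × Fin 4)) (dR : Fin 4) (LR : List (ℝ × Fin 4))
    (dT : Fin 4) (LT : List (ℝ × Fin 4)) (dL : Fin 4) (LL : List (ℝ × Fin 4)) : ℤ :=
  piecesTurns dB LB + qturn (piecesLastDir dB LB) dR + piecesTurns dR LR +
    qturn (piecesLastDir dR LR) (piecesLastDir dT LT) - piecesTurns dT LT +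
    qturn dT (piecesLastDir dL LL) - piecesTurns dL LL + qturn dL dB

/-- **The boundary integral from a certificate.** Let `f` be analytic on a neighbourhood of every
point of the closed rectangle `[a,b] × [c,d]`, and let the four edges carry valid piece lists
(bottom and top edges listed from `x = a` to `x = b`, left and right edges from `y = c` to
`y = d`). Then `∮_{∂K} f'/f = T · (π/2) i`, `T = certTurns …`. [folklore] -/
theorem rectBoundaryIntegral_logDeriv_eq_turns {f : ℂ → ℂ}
    (hf : AnalyticOnNhd ℂ f (Icc a b ×ℂ Icc c d))
    {xB : ℝ} {dB : Fin 4} {LB : List (ℝ × Fin 4)} (hB : HPieces f c a ((xB, dB) :: LB))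
    (hBe : piecesLast xB LB = b)
    {yR : ℝ} {dR : Fin 4} {LR : List (ℝ × Fin 4)} (hR : VPieces f b c ((yR, dR) :: LR))
    (hRe : piecesLast yR LR = d)
    {xT : ℝ} {dT : Fin 4} {LT : List (ℝ × Fin 4)} (hT : HPieces f d a ((xT, dT) :: LT))
    (hTe : piecesLast xT LT = b)
    {yL : ℝ} {dL : Fin 4} {LL : List (ℝ × Fin 4)} (hL : VPieces f a c ((yL, dL) :: LL))
    (hLe : piecesLast yL LL = d) :
    rectBoundaryIntegral (fun z ↦ deriv f z / f z) a b c d =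
      (certTurns dB LB dR LR dT LT dL LL : ℂ) * (π / 2) * I := by
  have hab : a ≤ b := by rw [← hBe]; exact hB.le_piecesLast
  have hcd : c ≤ d := by rw [← hRe]; exact hR.le_piecesLast
  have hfB : ∀ x ∈ Icc a (piecesLast xB LB), AnalyticAt ℂ f (x + c * I) := fun x hx ↦
    hf _ ⟨by simpa [hBe] using hx, by simpa using hcd⟩
  have hfT : ∀ x ∈ Icc a (piecesLast xT LT), AnalyticAt ℂ f (x + d * I) := fun x hx ↦
    hf _ ⟨by simpa [hTe] using hx, by simpa using hcd⟩
  have hfR : ∀ y ∈ Icc c (piecesLast yR LR), AnalyticAt ℂ f (b + y * I) := fun y hy ↦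
    hf _ ⟨by simpa using hab, by simpa [hRe] using hy⟩
  have hfL : ∀ y ∈ Icc c (piecesLast yL LL), AnalyticAt ℂ f (a + y * I) := fun y hy ↦
    hf _ ⟨by simpa using hab, by simpa [hLe] using hy⟩
  have eB := integral_logDeriv_hpieces hB hfB
  have eT := integral_logDeriv_hpieces hT hfT
  have eR := integral_logDeriv_vpieces hR hfR
  have eL := integral_logDeriv_vpieces hL hfL
  rw [hBe] at eB; rw [hTe] at eT; rw [hRe] at eR; rw [hLe] at eL
  -- values at the corners, in the two incident half-planes
  have pB0 := hB.re_pos_head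
  have pB1 := hB.re_pos_last; rw [hBe] at pB1
  have pR0 := hR.re_pos_head
  have pR1 := hR.re_pos_last; rw [hRe] at pR1
  have pT0 := hT.re_pos_head
  have pT1 := hT.re_pos_last; rw [hTe] at pT1
  have pL0 := hL.re_pos_head
  have pL1 := hL.re_pos_last; rw [hLe] at pL1
  -- the four corner junctions
  have jBR := log_qrot_sub_log_qrot pB1 pR0
  have jRT := log_qrot_sub_log_qrot pR1 pT1
  have jTL := log_qrot_sub_log_qrot pT0 pL1
  have jLB := log_qrot_sub_log_qrot pL0 pB0
  rw [rectBoundaryIntegral_def, eB, eT, eR, eL]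
  simp only [certTurns, Int.cast_add, Int.cast_sub]
  linear_combination jBR + jRT + jTL + jLB

/-- **Zero-freeness from a winding certificate.** With the hypotheses of
`rectBoundaryIntegral_logDeriv_eq_turns`, `a < b`, `c < d` and total turn count `T = 0`, the
function `f` has no zero in the open rectangle `(a,b) × (c,d)` (argument principle: the sum of
the multiplicities of the zeros is `T/4`). [folklore] -/
theorem no_zero_of_winding_certificate {f : ℂ → ℂ} (hab : a < b) (hcd : c < d)
    (hf : AnalyticOnNhd ℂ f (Icc a b ×ℂ Icc c d))
    {xB : ℝ} {dB : Fin 4} {LB : List (ℝ × Fin 4)} (hB : HPieces f c a ((xB, dB) :: LB))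
    (hBe : piecesLast xB LB = b)
    {yR : ℝ} {dR : Fin 4} {LR : List (ℝ × Fin 4)} (hR : VPieces f b c ((yR, dR) :: LR))
    (hRe : piecesLast yR LR = d)
    {xT : ℝ} {dT : Fin 4} {LT : List (ℝ × Fin 4)} (hT : HPieces f d a ((xT, dT) :: LT))
    (hTe : piecesLast xT LT = b)
    {yL : ℝ} {dL : Fin 4} {LL : List (ℝ × Fin 4)} (hL : VPieces f a c ((yL, dL) :: LL))
    (hLe : piecesLast yL LL = d)
    (hturns : certTurns dB LB dR LR dT LT dL LL = 0) :
    ∀ z ∈ Ioo a b ×ℂ Ioo c d, f z ≠ 0 := by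
  -- `f ≠ 0` on the four closed edges
  have h_bot : ∀ x ∈ Icc a b, f (x + c * I) ≠ 0 := fun x hx ↦
    hB.ne_zero x (by simpa [hBe] using hx) (by simp)
  have h_top : ∀ x ∈ Icc a b, f (x + d * I) ≠ 0 := fun x hx ↦
    hT.ne_zero x (by simpa [hTe] using hx) (by simp)
  have h_left : ∀ y ∈ Icc c d, f (a + y * I) ≠ 0 := fun y hy ↦
    hL.ne_zero y (by simpa [hLe] using hy) (by simp)
  have h_right : ∀ y ∈ Icc c d, f (b + y * I) ≠ 0 := fun y hy ↦
    hR.ne_zero y (by simpa [hRe] using hy) (by simp)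
  have hAP := integral_boundary_rect_logDeriv hab hcd hf h_bot h_top h_left h_right
  have hT' := rectBoundaryIntegral_logDeriv_eq_turns hf hB hBe hR hRe hT hTe hL hLe
  rw [rectBoundaryIntegral_def, hAP, hturns] at hT'
  simp only [Int.cast_zero, zero_mul] at hT'
  -- the finite sum of the orders vanishes
  have hcorner : ((a : ℂ) + c * I) ∈ Icc a b ×ℂ Icc c d :=
    ⟨by simpa using hab.le, by simpa using hcd.le⟩
  have hw : f (a + c * I) ≠ 0 := h_bot a ⟨le_rfl, hab.le⟩
  have hfin := finite_zeros_reProdIm hab.le hcd.le hf hcorner hw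
  rw [finsum_mem_eq_finite_toFinset_sum _ hfin] at hT'
  have hsum : ∑ ρ ∈ hfin.toFinset, ((meromorphicOrderAt f ρ).untop₀ : ℂ) = 0 := by
    have h2 : (2 * Real.pi * I : ℂ) ≠ 0 := by simp [Real.pi_ne_zero]
    exact (mul_eq_zero.1 hT').resolve_left h2
  -- each order is a positive natural number
  have hpos : ∀ ρ ∈ hfin.toFinset, (0 : ℤ) < (meromorphicOrderAt f ρ).untop₀ := by
    intro ρ hρ
    rw [Set.Finite.mem_toFinset] at hρ
    obtain ⟨h0, hρK⟩ := hρ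
    have hρK' : ρ ∈ Icc a b ×ℂ Icc c d := ⟨Ioo_subset_Icc_self hρK.1, Ioo_subset_Icc_self hρK.2⟩
    have han : AnalyticAt ℂ f ρ := hf ρ hρK'
    have hne := analyticOrderAt_ne_top_of_reProdIm hab.le hcd.le hf hcorner hw hρK'
    obtain ⟨n, hn⟩ := ENat.ne_top_iff_exists.mp hne
    have hn0 : n ≠ 0 := by
      intro h
      rw [h] at hn
      have : analyticOrderAt f ρ = 0 := by exact_mod_cast hn.symm
      rw [han.analyticOrderAt_eq_zero] at this
      exact this h0
    rw [han.meromorphicOrderAt_eq, ← hn]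
    simp only [ENat.map_coe, WithTop.untop₀_coe, Int.natCast_pos]
    omega
  intro z hz h0
  have hzmem : z ∈ hfin.toFinset := by
    rw [Set.Finite.mem_toFinset]; exact ⟨h0, hz⟩
  have hsumZ : ∑ ρ ∈ hfin.toFinset, (meromorphicOrderAt f ρ).untop₀ = 0 := by
    exact_mod_cast hsum
  have := Finset.sum_pos hpos ⟨z, hzmem⟩
  rw [hsumZ] at this
  exact lt_irrefl _ this

end Literature.Analysis.Complex

end
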